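import Summits.Schanuel.Schanuel.Theses.RootDecomp1K
import Summits.Schanuel.Schanuel.Theorems.RootDecomp1KNWMeasureHolds
import Summits.Schanuel.Schanuel.Theorems.RootDecomp1KB3LogBarrier03
import Literature.Barriers.Schanuel.NesterenkoModularScopeConjectureProofs

/-!
# RootDecomp1KB3LiouvilleSector — lens 6, generation 26, node 1 «THE RESIDUAL HIDES A LIOUVILLE SECTOR — AND A₁ ALREADY OWNS IT» (CLAIM L2380, PRICE + CHECKLIST G31-α L2383 (ruling (11): RECORD-ONLY, no item / route edit), NODE L2385 / REQUEST L2386; critic VERDICT L2388: CLEARED — CELL ×1 «algebraic-translate Liouville cell z⋆(α, b) strictly inside 31987» + AUDIT/THEOREM ×1 «residual shrink certificate 31987 = B₃ᴸ ∧ B₄, B₃ᴸ ⟸ 31077»; RULE G31; PORT GO) — part 1 (RootDecomp1KB3LiouvilleSector01): §1 kernel, §2 bookkeeping and the level-2 storey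

(lens-6 g26 HOME kernel K = HOME/decomp-schanuel-lens-6/g26/B3LiouvilleSector.lean db3352fb…, 652 l, imports Theses.RootDecomp1K + Theorems RootDecomp1KNWMeasureHolds / RootDecomp1KB3LogBarrier03 + Literature Barriers NesterenkoModularScopeConjectureProofs; P/C + NODE-g26.md. Port by census-1 gen 20 as `RootDecomp1KB3LiouvilleSector01–02`: 01 = §1 KERNEL `not_liouville_algebraic_add_liouvilleNumber (hα : IsAlgebraic ℚ α) (hirr : Irrational α) (hb : 2 ≤ b) : ¬ Liouville (α + liouvilleNumber b)` (LeVeque-window / Bugeaud §7.6 method; new in tree) + §2 field bookkeeping and the lever-exact level-2 storey `sb_two_of_isAlgebraic_polyMeasure_liouville`; 02 = §3 THE CELL `zStar α b = ![1, α + ℓ_b]` strictly inside B₃ decided hypothesis-free (`polyDiophantineSchanuel_at_zStar`, the three live B₃ binders at z⋆) + §4 RE-CARVING `AlgLiouvilleAdjacent` (P⁺), `AlgLiouvilleSectorSchanuel` (B₃ᴸ), `AlgDiophantineSchanuel` (B₄), `polyDiophantineSchanuel_iff : B₃ ↔ B₃ᴸ ∧ B₄`, transport `algLiouvilleSector_of_coordLiouvilleSchanuel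 : CoordLiouvilleSchanuel → AlgLiouvilleSectorSchanuel`, `closes_shrunk`, `algDiophantineSchanuel_of_schanuel`, shrink witness `zStar_mem_B3_not_B4`, flagship certificates `not_algLiouvilleAdjacent_one_piI` / (1, e) ∈ B₄.
PORT EDITS (sanctioned in VERDICT L2388 (a)–(c)): linter option dropped; two one-line docstrings added (`zStar_zero`, `zStar_one`); the three `def … : Prop` carry the census statement tags — `AlgLiouvilleAdjacent` «[carving predicate] definition», `AlgLiouvilleSectorSchanuel` / `AlgDiophantineSchanuel` «[restriction] definition — NOT a fact and NOT a new obligation; equals the live B₃ body plus one binder» (ruling (11): RECORD-ONLY) — and part 02 is filed definition-kind (review lane); two generic helpers `trdeg_mono` (≡ Literature.Barriers.Schanuel.trdeg_mono) and `trdeg_adjoin_le_mk` (≡ RootDecomp1DFlagSplit.trdeg_adjoin_le_cardinalMk) made PRIVATE after the dry-run dedup.landed finding (private copy of the latter in 02); statements and proofs verbatim, no renames of the nine checklist decls. `--supports stmt-Schanuel-31987`; no census credit carried; rung 0 — nothing here proves Schanuel; no item closes.)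
-/

/-!
# RootDecomp1K — lens 6, generation 26, node 1 (g26) «THE RESIDUAL HIDES A LIOUVILLE SECTOR — AND A₁ ALREADY OWNS IT»

Target: the declared residual `B₃ = PolyDiophantineSchanuel` (stmt-Schanuel-31987) of
`route-Schanuel-RootDecomp1K` (standing rule F2⁗-1K (ii): «a decided cell / certified open member
strictly inside A₄ᵈ 33364 or B₃ 31987»).

* §1 KERNEL (hypothesis-free Diophantine theorem, LeVeque's window; print: Bugeaud 2004, §7.6,
  proof of Thm 7.4, (7.32)–(7.34)): an algebraic irrational translate of Liouville's constant is
  NOT a Liouville number: `¬ Liouville (α + liouvilleNumber b)`.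
* §2 LEVER-EXACT STOREY: a measured `θ` and a Liouville `L` that are merely ALGEBRAIC over the
  Schanuel field `ℚ(z, e^z)` of a pair decide Schanuel's bound there.
* §3 CELL strictly inside `B₃`: `z⋆(α, b) = (1, α + ℓ_b)` meets the three live `B₃` binders and
  `SB 2 z⋆`, hypothesis-free; literal item instance.
* §4 RE-CARVING `B₃ ⟺ B₃ᴸ ∧ B₄` by the cut `P⁺ z := ∃ L, Liouville L ∧ L algebraic over ℚ(z)`,
  TRANSPORT `CoordLiouvilleSchanuel → B₃ᴸ` (A₁ already owns the sector), `closes_shrunk`,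
  necessity, explicit shrink witness, flagship certificate `(1, iπ) ∈ scope B₄`.
-/

noncomputable section

open Polynomial LiouvilleNumber Real Complex IntermediateField
open scoped Nat

namespace Summit.Schanuel.Schanuel.Theorems.RootDecomp1KB3LiouvilleSector

open Summit.Schanuel.Schanuel.Theorems.RootDecomp1KHyper

/-! ## §1. KERNEL — an algebraic irrational translate of Liouville's constant is not Liouville -/

/-- **Liouville's inequality, packaged.** A real algebraic irrational `α` has an exponent `D` and a
constant `A > 0` with `1/(A q^D) ≤ |α − a/q|` for all integers `a` and naturals `q ≥ 1`
(Mathlib `Liouville.exists_pos_real_of_irrational_root`). -/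
theorem exists_liouville_inequality {α : ℝ} (hα : IsAlgebraic ℚ α) (hirr : Irrational α) :
    ∃ D : ℕ, ∃ A : ℝ, 0 < A ∧ ∀ (a : ℤ) (q : ℕ), 1 ≤ q → 1 / (A * (q : ℝ) ^ D) ≤ |α - a / q| := by
  have hZ : IsAlgebraic ℤ α := (IsFractionRing.isAlgebraic_iff ℤ ℚ ℝ).mpr hα
  obtain ⟨f, hf0, hfα⟩ := hZ
  have fa : eval α (map (algebraMap ℤ ℝ) f) = 0 := by rwa [eval_map, ← aeval_def]
  obtain ⟨A, hA, h⟩ := Liouville.exists_pos_real_of_irrational_root hirr hf0 fa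
  refine ⟨f.natDegree, A, hA, fun a q hq => ?_⟩
  obtain ⟨b, rfl⟩ : ∃ b : ℕ, q = b + 1 := ⟨q - 1, by omega⟩
  have h1 := h a b
  have hbpos : (0 : ℝ) < (b : ℝ) + 1 := by positivity
  have hpow : (0 : ℝ) < ((b : ℝ) + 1) ^ f.natDegree := by positivity
  push_cast
  rw [div_le_iff₀ (by positivity)]
  have e : ((b : ℝ) + 1) ^ f.natDegree * (|α - a / ((b : ℝ) + 1)| * A)
      = |α - a / ((b : ℝ) + 1)| * (A * ((b : ℝ) + 1) ^ f.natDegree) := by ring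
  linarith [h1, e]

/-- `b^{(m+1)!} = (b^{m!})^{m+1}`. -/
theorem base_pow_factorial_succ (b : ℝ) (m : ℕ) : b ^ (m + 1)! = (b ^ m !) ^ (m + 1) := by
  rw [Nat.factorial_succ, mul_comm, pow_mul]

/-- **The key inequality at every level `n`.** If `|α + ℓ_b − a/q| < ε` then
`1/(A (q b^{n!})^D) < ε + 1/(b^{n!})^n`: apply Liouville's inequality for `α` to the rational
`a/q − p_n/b^{n!}` (`p_n/b^{n!}` the `n`-th partial sum of `ℓ_b`) and use the remainder estimate
`0 < ℓ_b − p_n/b^{n!} < (b^{n!})^{-n}` (Mathlib `LiouvilleNumber.remainder_lt`). -/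
theorem level_inequality {α A : ℝ} {D : ℕ}
    (hineq : ∀ (a : ℤ) (q : ℕ), 1 ≤ q → 1 / (A * (q : ℝ) ^ D) ≤ |α - a / q|)
    {b : ℕ} (hb : 2 ≤ b) {a : ℤ} {q : ℕ} (hq : 1 ≤ q) {ε : ℝ}
    (hlt : |α + liouvilleNumber b - a / q| < ε) (n : ℕ) :
    1 / (A * ((q : ℝ) * (b : ℝ) ^ n !) ^ D) < ε + 1 / ((b : ℝ) ^ n !) ^ n := by
  have hb0 : 0 < b := by omega
  have hb1R : (1 : ℝ) < b := by exact_mod_cast (lt_of_lt_of_le one_lt_two hb)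
  have hb2R : (2 : ℝ) ≤ b := by exact_mod_cast hb
  have hQpos : (0 : ℝ) < (b : ℝ) ^ n ! := by positivity
  obtain ⟨p, hp⟩ := partialSum_eq_rat hb0 n
  have hsum := partialSum_add_remainder hb1R n
  have hrpos := remainder_pos hb1R n
  have hrlt := remainder_lt n hb2R
  have hq' : 1 ≤ q * b ^ n ! := Nat.one_le_iff_ne_zero.mpr (by positivity)
  have h1 := hineq (a * (b : ℤ) ^ (n !) - (q : ℤ) * (p : ℤ)) (q * b ^ n !) hq'
  have e1 : ((q * b ^ n ! : ℕ) : ℝ) = (q : ℝ) * (b : ℝ) ^ n ! := by push_cast; ring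
  have hqR : (0 : ℝ) < q := by exact_mod_cast hq
  have e2 : ((a * (b : ℤ) ^ (n !) - (q : ℤ) * (p : ℤ) : ℤ) : ℝ) / ((q * b ^ n ! : ℕ) : ℝ)
      = (a : ℝ) / q - (p : ℝ) / (b : ℝ) ^ n ! := by
    rw [e1]; push_cast
    field_simp
  rw [e2, e1] at h1
  have e3 : α - ((a : ℝ) / q - (p : ℝ) / (b : ℝ) ^ n !)
      = (α + liouvilleNumber b - a / q) - remainder b n := by
    rw [← hsum, hp]; push_cast; ring
  rw [e3] at h1
  calc 1 / (A * ((q : ℝ) * (b : ℝ) ^ n !) ^ D)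
      ≤ |(α + liouvilleNumber ↑b - a / q) - remainder (↑b) n| := h1
    _ ≤ |α + liouvilleNumber ↑b - a / q| + |remainder (↑b) n| := abs_sub _ _
    _ < ε + 1 / ((b : ℝ) ^ n !) ^ n := by
        rw [abs_of_pos hrpos]; exact add_lt_add hlt hrlt

/-- **KERNEL THEOREM (hypothesis-free).** For a real algebraic irrational `α` and an integer base
`b ≥ 2`, the translate `α + ℓ_b` of Liouville's constant `ℓ_b = Σ_k b^{-k!}` is NOT a Liouville
number (its irrationality exponent is at most `D(2D+1)`, `D` the degree of an integer annihilator
of `α`).  LeVeque's window: with `Q_n = b^{n!}` pick the least level `n ≥ 2D+2` with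
`2A q^D Q_n^D < Q_n^n`; then `q^μ < 2A q^D Q_n^D` while `Q_n^D ≤ (2A q^D)^{2D}` (or `n` is the
base level), absurd for `μ = D(2D+1) + k`, `2^k ≥` the constants. -/
theorem not_liouville_algebraic_add_liouvilleNumber {α : ℝ} (hα : IsAlgebraic ℚ α)
    (hirr : Irrational α) {b : ℕ} (hb : 2 ≤ b) : ¬ Liouville (α + liouvilleNumber b) := by
  obtain ⟨D, A, hA, hineq⟩ := exists_liouville_inequality hα hirr
  intro hL
  have hb2R : (2 : ℝ) ≤ b := by exact_mod_cast hb
  have hb1R : (1 : ℝ) ≤ b := by linarith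
  -- the constants
  set n₀ : ℕ := 2 * D + 2 with hn₀
  set K₁ : ℝ := 2 * A * ((b : ℝ) ^ n₀ !) ^ D with hK₁
  set K₂ : ℝ := (2 * A) ^ (2 * D + 1) with hK₂
  obtain ⟨k, hk⟩ := exists_le_two_pow (max K₁ K₂)
  have hK₁k : K₁ ≤ (2 : ℝ) ^ k := (le_max_left _ _).trans hk
  have hK₂k : K₂ ≤ (2 : ℝ) ^ k := (le_max_right _ _).trans hk
  set μ : ℕ := D * (2 * D + 1) + k with hμ
  obtain ⟨a, b', hb', -, hlt⟩ := hL μ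
  obtain ⟨q, rfl⟩ : ∃ q : ℕ, b' = q := ⟨b'.toNat, (Int.toNat_of_nonneg (by omega)).symm⟩
  have hq2 : 2 ≤ q := by exact_mod_cast (show (2 : ℤ) ≤ q by omega)
  have hq1 : 1 ≤ q := by omega
  have hq2R : (2 : ℝ) ≤ q := by exact_mod_cast hq2
  have hq1R : (1 : ℝ) ≤ q := by linarith
  have hqpos : (0 : ℝ) < q := by linarith
  simp only [Int.cast_natCast] at hlt
  -- `Q n = b^{n!}` facts
  have hQ1 : ∀ n, (1 : ℝ) ≤ (b : ℝ) ^ n ! := fun n => one_le_pow₀ hb1R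
  have hQ2 : ∀ n, (2 : ℝ) ≤ (b : ℝ) ^ n ! := fun n =>
    le_trans (by simpa using hb2R) (pow_le_pow_right₀ hb1R (Nat.one_le_iff_ne_zero.mpr (Nat.factorial_ne_zero n)))
  have hQpos : ∀ n, (0 : ℝ) < (b : ℝ) ^ n ! := fun n => by positivity
  set Y : ℝ := 2 * A * (q : ℝ) ^ D with hY
  have hYpos : 0 < Y := by positivity
  -- from a good level, the bound `q^μ < Y · Q_n^D`
  have step : ∀ n, Y * ((b : ℝ) ^ n !) ^ D < ((b : ℝ) ^ n !) ^ n →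
      (q : ℝ) ^ μ < Y * ((b : ℝ) ^ n !) ^ D := by
    intro n hg
    have hk := level_inequality hineq hb hq1 hlt n
    rw [mul_pow] at hk
    set Q : ℝ := (b : ℝ) ^ n ! with hQ
    have hQD : (0 : ℝ) < Q ^ D := pow_pos (hQpos n) D
    have hg' : 1 / Q ^ n < 1 / (Y * Q ^ D) := one_div_lt_one_div_of_lt (by positivity) hg
    have e : 1 / (A * ((q : ℝ) ^ D * Q ^ D)) = 1 / (Y * Q ^ D) + 1 / (Y * Q ^ D) := by
      rw [hY]; field_simp; ring
    have h2 : 1 / (Y * Q ^ D) < 1 / (q : ℝ) ^ μ := by linarith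
    exact lt_of_one_div_lt_one_div (by positivity) h2
  -- the base level is contradictory
  have base : Y * ((b : ℝ) ^ n₀ !) ^ D < ((b : ℝ) ^ n₀ !) ^ n₀ → False := by
    intro hg
    have h := step n₀ hg
    have e : Y * ((b : ℝ) ^ n₀ !) ^ D = K₁ * (q : ℝ) ^ D := by rw [hY, hK₁]; ring
    rw [e] at h
    -- lower bound `q^μ ≥ q^D · 2^k ≥ q^D · K₁`
    have hμD : D + k ≤ μ := by rw [hμ]; nlinarith
    have hlow : (q : ℝ) ^ D * K₁ ≤ (q : ℝ) ^ μ :=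
      calc (q : ℝ) ^ D * K₁ ≤ (q : ℝ) ^ D * (2 : ℝ) ^ k := by gcongr
        _ ≤ (q : ℝ) ^ D * (q : ℝ) ^ k := by gcongr
        _ = (q : ℝ) ^ (D + k) := by rw [pow_add]
        _ ≤ (q : ℝ) ^ μ := pow_le_pow_right₀ hq1R hμD
    linarith
  -- the window is contradictory: `¬ good m`, `good (m+1)`, `m ≥ n₀`
  have window : ∀ m, n₀ ≤ m → ¬ (Y * ((b : ℝ) ^ m !) ^ D < ((b : ℝ) ^ m !) ^ m) →
      Y * ((b : ℝ) ^ (m + 1)!) ^ D < ((b : ℝ) ^ (m + 1)!) ^ (m + 1) → False := by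
    intro m hm hng hg
    have h := step (m + 1) hg
    set X : ℝ := (b : ℝ) ^ m ! with hX
    have hX1 : 1 ≤ X := hQ1 m
    have hXpos : 0 < X := hQpos m
    obtain ⟨t, rfl⟩ : ∃ t, m = t + D := ⟨m - D, by omega⟩
    have ht : D + 2 ≤ t := by omega
    -- `X^t ≤ Y` from `¬ good m`
    have hng' : X ^ (t + D) ≤ Y * X ^ D := not_lt.mp hng
    have hXt : X ^ t ≤ Y := by
      rw [pow_add] at hng'
      exact le_of_mul_le_mul_right hng' (pow_pos hXpos D)
    -- `Q_{m+1}^D = X^{(m+1) D} ≤ X^{2 D t} = (X^t)^{2D} ≤ Y^{2D}`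
    have hsucc : (b : ℝ) ^ (t + D + 1)! = X ^ (t + D + 1) := by
      rw [hX]; exact base_pow_factorial_succ (b : ℝ) (t + D)
    have hexp : (t + D + 1) * D ≤ t * (2 * D) := by
      have h1 : D * (D + 2) ≤ D * t := Nat.mul_le_mul_left D ht
      nlinarith
    have hQD : ((b : ℝ) ^ (t + D + 1)!) ^ D ≤ Y ^ (2 * D) :=
      calc ((b : ℝ) ^ (t + D + 1)!) ^ D = X ^ ((t + D + 1) * D) := by rw [hsucc, ← pow_mul]
        _ ≤ X ^ (t * (2 * D)) := pow_le_pow_right₀ hX1 hexp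
        _ = (X ^ t) ^ (2 * D) := by rw [pow_mul]
        _ ≤ Y ^ (2 * D) := pow_le_pow_left₀ (pow_nonneg hXpos.le t) hXt (2 * D)
    have hup : (q : ℝ) ^ μ < K₂ * (q : ℝ) ^ (D * (2 * D + 1)) :=
      calc (q : ℝ) ^ μ < Y * ((b : ℝ) ^ (t + D + 1)!) ^ D := h
        _ ≤ Y * Y ^ (2 * D) := by gcongr
        _ = Y ^ (2 * D + 1) := by ring
        _ = K₂ * (q : ℝ) ^ (D * (2 * D + 1)) := by
            rw [hY, hK₂, mul_pow, ← pow_mul]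
    have hlow : K₂ * (q : ℝ) ^ (D * (2 * D + 1)) ≤ (q : ℝ) ^ μ :=
      calc K₂ * (q : ℝ) ^ (D * (2 * D + 1)) ≤ (2 : ℝ) ^ k * (q : ℝ) ^ (D * (2 * D + 1)) := by
            gcongr
        _ ≤ (q : ℝ) ^ k * (q : ℝ) ^ (D * (2 * D + 1)) := by gcongr
        _ = (q : ℝ) ^ μ := by rw [hμ, ← pow_add, add_comm]
    linarith
  -- induction from the base level: no level `n ≥ n₀` is good
  have main : ∀ n, n₀ ≤ n → Y * ((b : ℝ) ^ n !) ^ D < ((b : ℝ) ^ n !) ^ n → False := by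
    intro n hn
    induction n, hn using Nat.le_induction with
    | base => exact base
    | succ m hm ih =>
        intro hg
        by_cases hgm : Y * ((b : ℝ) ^ m !) ^ D < ((b : ℝ) ^ m !) ^ m
        · exact ih hgm
        · exact window m hm hgm hg
  -- but a good level exists
  obtain ⟨c, hc⟩ := exists_le_two_pow Y
  set n₁ : ℕ := max n₀ (D + c + 1) with hn₁
  refine main n₁ (le_max_left _ _) ?_
  set X : ℝ := (b : ℝ) ^ n₁ ! with hX
  have hX2 : 2 ≤ X := hQ2 n₁
  have hXpos : 0 < X := hQpos n₁
  have hDn : D ≤ n₁ := by omega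
  have hcn : c + 1 ≤ n₁ - D := by omega
  have h1 : Y < X ^ (n₁ - D) :=
    calc Y ≤ (2 : ℝ) ^ c := hc
      _ < (2 : ℝ) ^ (c + 1) := pow_lt_pow_right₀ one_lt_two (Nat.lt_succ_self c)
      _ ≤ X ^ (c + 1) := pow_le_pow_left₀ (by norm_num) hX2 (c + 1)
      _ ≤ X ^ (n₁ - D) := pow_le_pow_right₀ (by linarith) hcn
  calc Y * X ^ D < X ^ (n₁ - D) * X ^ D := mul_lt_mul_of_pos_right h1 (pow_pos hXpos D)
    _ = X ^ n₁ := by rw [← pow_add, Nat.sub_add_cancel hDn]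

/-- Rational affine images: `Liouville (r x + s) ↔ Liouville x` for rationals `r ≠ 0`, `s`
(Mathlib `LiouvilleWith.rat_mul_iff`, `LiouvilleWith.add_rat_iff`). -/
theorem liouville_rat_mul_add_rat_iff {x : ℝ} {r s : ℚ} (hr : r ≠ 0) :
    Liouville ((r : ℝ) * x + s) ↔ Liouville x := by
  rw [← forall_liouvilleWith_iff, ← forall_liouvilleWith_iff]
  refine forall_congr' fun p => ?_
  rw [LiouvilleWith.add_rat_iff, LiouvilleWith.rat_mul_iff hr]

/-- A rational number is not Liouville. -/
theorem not_liouville_ratCast (s : ℚ) : ¬ Liouville (s : ℝ) := fun h =>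
  (Rat.not_irrational s) h.irrational

/-- `α + ℓ_b` is irrational (indeed transcendental: `ℓ_b` is, `α` is algebraic). -/
theorem irrational_algebraic_add_liouvilleNumber {α : ℝ} (hα : IsAlgebraic ℚ α) {b : ℕ}
    (hb : 2 ≤ b) : Irrational (α + liouvilleNumber b) := by
  refine Transcendental.irrational fun halg => ?_
  apply transcendental_liouvilleNumber hb
  have h1 : IsIntegral ℚ (α + liouvilleNumber b) := isAlgebraic_iff_isIntegral.mp halg
  have h2 : IsIntegral ℚ α := isAlgebraic_iff_isIntegral.mp hα
  have h3 : IsIntegral ℚ (α + liouvilleNumber b - α) := h1.sub h2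
  rw [add_sub_cancel_left] at h3
  exact (IsFractionRing.isAlgebraic_iff ℤ ℚ ℝ).mpr (isAlgebraic_iff_isIntegral.mpr h3)

/-! ## §2. Field-theoretic bookkeeping and the LEVER-EXACT level-2 storey -/

/-- `trdeg_ℚ` is monotone along inclusions of subfields (Mathlib `trdeg_le_of_injective`; the
tree's copy in `RootDecomp1KHyper01` is private). -/
private theorem trdeg_mono {F E : Type*} [Field F] [Field E] [Algebra F E] {L L' : IntermediateField F E}
    (h : L ≤ L') : Algebra.trdeg F L ≤ Algebra.trdeg F L' :=
  trdeg_le_of_injective (IntermediateField.inclusion h) (IntermediateField.inclusion_injective h)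

/-- A field generated by `S` has transcendence degree `≤ #S` (copy of the tree's
`Literature.NumberTheory.Transcendental.trdeg_adjoin_le_mk`, whose module is outside this cone). -/
private theorem trdeg_adjoin_le_mk {F E : Type*} [Field F] [Field E] [Algebra F E] (S : Set E) :
    Algebra.trdeg F ↥(adjoin F S) ≤ Cardinal.mk S := by
  haveI := Literature.NumberTheory.Transcendental.isAlgebraic_adjoin_over_algebraAdjoin (F := F) S
  exact (Algebra.IsAlgebraic.trdeg_le_cardinalMk F (((↑) : adjoin F S → E) ⁻¹' S)).trans
    (Cardinal.mk_preimage_of_injective _ _ Subtype.val_injective)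

/-- Sub-additivity with a counted second summand: `trdeg_K K(S ∪ T) ≤ trdeg_K K(S) + #T`
(tower law along `K ⊆ K(S) ⊆ K(S)(T) = K(S ∪ T)`). -/
theorem trdeg_adjoin_union_le_add_mk {K E : Type*} [Field K] [Field E] [Algebra K E]
    (S T : Set E) :
    Algebra.trdeg K (adjoin K (S ∪ T)) ≤ Algebra.trdeg K (adjoin K S) + Cardinal.mk T := by
  haveI : FaithfulSMul (adjoin K S) (adjoin (adjoin K S) T) :=
    (faithfulSMul_iff_algebraMap_injective (adjoin K S) (adjoin (adjoin K S) T)).mpr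
      (algebraMap (adjoin K S) (adjoin (adjoin K S) T)).injective
  have htower := trdeg_add_eq K (adjoin K S) (A := adjoin (adjoin K S) T)
  have heq : Algebra.trdeg K (adjoin (adjoin K S) T) = Algebra.trdeg K (adjoin K (S ∪ T)) := by
    rw [← (equivOfEq (adjoin_adjoin_left K S T)).trdeg_eq]
    rfl
  rw [← heq, ← htower]
  exact add_le_add (le_refl _) (trdeg_adjoin_le_mk (F := adjoin K S) T)

/-- Algebraicity passes UP along an inclusion of intermediate fields. -/
theorem isAlgebraic_of_le {F E : Type*} [Field F] [Field E] [Algebra F E]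
    {K K' : IntermediateField F E} (h : K ≤ K') {x : E} (hx : IsAlgebraic K x) :
    IsAlgebraic K' x := by
  letI : Algebra K K' := (IntermediateField.inclusion h).toRingHom.toAlgebra
  haveI : IsScalarTower K K' E := IsScalarTower.of_algebraMap_eq (fun _ => rfl)
  exact hx.extendScalars (fun a b hab => IntermediateField.inclusion_injective h hab)

/-- `k` algebraically independent numbers lying in a subfield `M` force `trdeg_ℚ M ≥ k`
(Mathlib `AlgebraicIndependent.cardinalMk_le_trdeg`; the tree's version is private). -/
theorem le_trdeg_of_algebraicIndependent {k : ℕ} {u : Fin k → ℂ} (hai : AlgebraicIndependent ℚ u)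
    {M : IntermediateField ℚ ℂ} (hu : ∀ i, u i ∈ M) : (k : Cardinal) ≤ Algebra.trdeg ℚ M := by
  let u' : Fin k → M := fun i => ⟨u i, hu i⟩
  have hai' : AlgebraicIndependent ℚ u' := AlgebraicIndependent.of_comp M.val (by exact hai)
  simpa using hai'.cardinalMk_le_trdeg

/-- **LEVER-EXACT LEVEL-2 STOREY.** A measured `θ` (`PolyMeasure`) and a Liouville `L` that are
merely ALGEBRAIC over the Schanuel field `ℚ(z, e^z)` of a pair decide Schanuel's bound there
(extraction `algebraicIndependent_of_polyMeasure_liouville` + the relative tower law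
`Literature.Barriers.Schanuel.trdeg_adjoin_union_eq_of_isAlgebraic_adjoin`).  The tree's
`sb_two_of_polyMeasure_liouville` is the sub-case `θ, L ∈ ℚ(z, e^z, i)`. -/
theorem sb_two_of_isAlgebraic_polyMeasure_liouville {θ : ℂ} (hθ : PolyMeasure θ) {L : ℝ}
    (hL : Liouville L) {z : Fin 2 → ℂ} (hθz : IsAlgebraic ↥(adjoin ℚ (SFset z)) θ)
    (hLz : IsAlgebraic ↥(adjoin ℚ (SFset z)) (L : ℂ)) : SB 2 z := by
  have hai := algebraicIndependent_of_polyMeasure_liouville hθ hL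
  have h2 := le_trdeg_of_algebraicIndependent hai (M := adjoin ℚ (SFset z ∪ {θ, (L : ℂ)}))
    (fun i => by
      fin_cases i
      · exact subset_adjoin ℚ _ (Or.inr (by simp))
      · exact subset_adjoin ℚ _ (Or.inr (by simp)))
  have heq := Literature.Barriers.Schanuel.trdeg_adjoin_union_eq_of_isAlgebraic_adjoin
    (K := ℚ) (SFset z) ({θ, (L : ℂ)} : Set ℂ) (by
      intro x hx
      rcases hx with rfl | rfl
      · exact hθz
      · simpa using hLz)
  exact h2.trans heq.le

end Summit.Schanuel.Schanuel.Theorems.RootDecomp1KB3LiouvilleSector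

end
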